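import Summits.MatrixMultiplication.OmegaCensus.STPPVosperCoverStage

/-!
# ω-census (abelian STPP census): the exact-cover checker with a GENERAL Z-point list, its soundness, and the cover stage for general `Y°`/`Z°` shapes (kernel)

HONEST FRAMING (pub-omega census; verbatim): lottery ticket; floor = certified bounds/negative ranges.
Census STRUCTURE (seat pub-omega-stpp-1 gen 31, 2026-08-28), family (b2).  `existsCover` (`STPPVosperTilingTools.lean`) hard-codes the Z-points as
`[0, z)`, i.e. `Z° = ⋃_{k≠i}(C_k − A_k)` a PROGRESSION.  In the slack-1 cases β (Hamidoune–Rødseth side `(Bᵢ, V)`) and β₂ (`|Bᵢ| = 2`), `Z° = H ∖ (Bᵢ + V)`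
is NOT a progression (a progression plus a point, resp. two progressions).  THIS FILE is the groundwork for those cases: `existsCoverZ p YL ZL blocks`
(the same search with an arbitrary Z-point list `ZL`), its soundness `existsCoverZ_complete` (verbatim adaptation of `existsCover_complete`), and the
cover stage `existsCoverZ_true_of_isSTPP` for an STPP family whose `Y°` and `Z°` are described by value lists relative to base points `y₀`, `z₀` and a unit
`u` (adaptation of `existsCover_true_of_isSTPP`).  No law in this file uses it yet (successor item: β-cover laws).  UNCONDITIONAL; nothing here is progress
on `ω`.  Python mirror: HOME `pub-omega-stpp-1-g31/code/cover_mirror_z.py`.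

References: A. G. Vosper, J. London Math. Soc. 31 (1956); H. Cohn, R. Kleinberg, B. Szegedy, C. Umans, FOCS 2005 (arXiv:math/0511460), Def. 5.1.
-/

open Finset
open scoped Pointwise

namespace Summit.MatrixMultiplication.OmegaCensus.CubeNB

open Literature.Computability.AlgebraicComplexity
open Literature.Combinatorics.Additive
open Summit.MatrixMultiplication.OmegaCensus.STPPKneser

/-! ## The checker with a Z-point list -/

section Cover

/-- Candidate difference data of ONE block of sizes `(a, b, c)`: all `(Y_k, Z_k) = (C − B, C − A)` (as lists of residues) with `C` a `c`-sublist of the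
Y-points `YL`, `B = 0 :: B'` with `C − B ⊆ Y-points`, `A` with `C − A ⊆ [0, z)` (the Z-points), all three difference lists `C − B`, `C − A`, `A − B`
duplicate-free. [folklore] -/
def blockDiffsZ (p : ℕ) (YL ZL : List ℕ) (a b c : ℕ) : List (List ℕ × List ℕ) :=
  (YL.sublistsLen c).flatMap fun C =>
    (((candShift p C fun y => decide (y ∈ YL)).filter fun x => x != 0).sublistsLen (b - 1)).flatMap fun B' =>
      ((candShift p C fun t => decide (t ∈ ZL)).sublistsLen a).filterMap fun A =>
        if (diffList p C (0 :: B')).Nodup && (diffList p C A).Nodup && (diffList p A (0 :: B')).Nodup then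
          some (diffList p C (0 :: B'), diffList p C A) else none

/-- **Exact-cover search.**  `existsCover p z YL blocks uY uZ`: can the blocks (sizes `(a,b,c)`, in order) be realised with difference data from
`blockDiffs`, disjoint from the already used residues `uY`, `uZ` (and, recursively, from each other), so that finally every Y-point is in `uY` and every
`t < z` in `uZ`? [folklore] -/
def existsCoverZ (p : ℕ) (YL ZL : List ℕ) : List (ℕ × ℕ × ℕ) → List ℕ → List ℕ → Bool
  | [], uY, uZ => (YL.all fun y => decide (y ∈ uY)) && (ZL.all fun t => decide (t ∈ uZ))
  | (a, b, c) :: rest, uY, uZ =>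
    (blockDiffsZ p YL ZL a b c).any fun YZ =>
      (YZ.1.all fun y => !(decide (y ∈ uY))) && (YZ.2.all fun t => !(decide (t ∈ uZ))) && existsCoverZ p YL ZL rest (YZ.1 ++ uY) (YZ.2 ++ uZ)


end Cover

/-! ## Soundness -/

section Sound

/-- Membership in `blockDiffs` (the witnesses spelled out). [folklore] -/
theorem mem_blockDiffsZ {p : ℕ} {YL ZL : List ℕ} {a b c : ℕ} {C B' A : List ℕ}
    (hC : C ∈ YL.sublistsLen c) (hB : B' ∈ ((candShift p C fun y => decide (y ∈ YL)).filter fun x => x != 0).sublistsLen (b - 1))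
    (hA : A ∈ (candShift p C fun t => decide (t ∈ ZL)).sublistsLen a)
    (h1 : (diffList p C (0 :: B')).Nodup) (h2 : (diffList p C A).Nodup) (h3 : (diffList p A (0 :: B')).Nodup) :
    (diffList p C (0 :: B'), diffList p C A) ∈ blockDiffsZ p YL ZL a b c := by
  rw [blockDiffsZ, List.mem_flatMap]
  refine ⟨C, hC, ?_⟩
  rw [List.mem_flatMap]
  refine ⟨B', hB, ?_⟩
  rw [List.mem_filterMap]
  refine ⟨A, hA, ?_⟩
  simp [h1, h2, h3]


variable {ι : Type*}

/-- **Soundness of the exact-cover checker.**  Blocks `k ∈ ks` (duplicate-free, all `good`) with value sets `Av k, Bv k, Cv k ⊆ [0, p)` of sizes `sz k = (a,b,c)`,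
`0 ∈ Bv k`, all differences `(c − x) mod p` (`c ∈ Cv k`, `x ∈ Bv k`) among the Y-points `YL` (duplicate-free), all `(c − x) mod p`
(`x ∈ Av k`) below `z`, the three difference maps injective, the Y-difference sets pairwise disjoint and disjoint from `uY` and together with `uY`
covering `YL` (likewise `Z` with `[0, z)`): then `existsCover p z YL (ks.map sz) uY uZ = true`. [folklore] -/
theorem existsCoverZ_complete {p : ℕ} {YL ZL : List ℕ} (hYL : YL.Nodup) (good : ι → Prop)
    (sz : ι → ℕ × ℕ × ℕ) (Av Bv Cv : ι → Finset ℕ)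
    (hszA : ∀ k, good k → #(Av k) = (sz k).1) (hszB : ∀ k, good k → #(Bv k) = (sz k).2.1) (hszC : ∀ k, good k → #(Cv k) = (sz k).2.2)
    (hAp : ∀ k, ∀ x ∈ Av k, x < p) (hBp : ∀ k, ∀ x ∈ Bv k, x < p) (hCp : ∀ k, ∀ x ∈ Cv k, x < p) (hB0 : ∀ k, good k → 0 ∈ Bv k)
    (hY : ∀ k, good k → ∀ c ∈ Cv k, ∀ x ∈ Bv k, (c + p - x) % p ∈ YL) (hZ : ∀ k, good k → ∀ c ∈ Cv k, ∀ x ∈ Av k, (c + p - x) % p ∈ ZL)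
    (hinjY : ∀ k, good k → ∀ c ∈ Cv k, ∀ c' ∈ Cv k, ∀ x ∈ Bv k, ∀ x' ∈ Bv k, (c + p - x) % p = (c' + p - x') % p → c = c' ∧ x = x')
    (hinjZ : ∀ k, good k → ∀ c ∈ Cv k, ∀ c' ∈ Cv k, ∀ x ∈ Av k, ∀ x' ∈ Av k, (c + p - x) % p = (c' + p - x') % p → c = c' ∧ x = x')
    (hinjX : ∀ k, good k → ∀ c ∈ Av k, ∀ c' ∈ Av k, ∀ x ∈ Bv k, ∀ x' ∈ Bv k, (c + p - x) % p = (c' + p - x') % p → c = c' ∧ x = x') :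
    ∀ (ks : List ι), ks.Nodup → (∀ k ∈ ks, good k) → ∀ (uY uZ : List ℕ),
      (∀ k ∈ ks, ∀ c ∈ Cv k, ∀ x ∈ Bv k, (c + p - x) % p ∉ uY) →
      (∀ k ∈ ks, ∀ k' ∈ ks, k ≠ k' → ∀ c ∈ Cv k, ∀ x ∈ Bv k, ∀ c' ∈ Cv k', ∀ x' ∈ Bv k', (c + p - x) % p ≠ (c' + p - x') % p) →
      (∀ y ∈ YL, y ∈ uY ∨ ∃ k ∈ ks, ∃ c ∈ Cv k, ∃ x ∈ Bv k, (c + p - x) % p = y) →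
      (∀ k ∈ ks, ∀ c ∈ Cv k, ∀ x ∈ Av k, (c + p - x) % p ∉ uZ) →
      (∀ k ∈ ks, ∀ k' ∈ ks, k ≠ k' → ∀ c ∈ Cv k, ∀ x ∈ Av k, ∀ c' ∈ Cv k', ∀ x' ∈ Av k', (c + p - x) % p ≠ (c' + p - x') % p) →
      (∀ t ∈ ZL, t ∈ uZ ∨ ∃ k ∈ ks, ∃ c ∈ Cv k, ∃ x ∈ Av k, (c + p - x) % p = t) →
      existsCoverZ p YL ZL (ks.map sz) uY uZ = true := by
  intro ks
  induction ks with
  | nil =>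
    intro _ _ uY uZ _ _ hcovY _ _ hcovZ
    rw [List.map_nil, existsCoverZ, Bool.and_eq_true, List.all_eq_true, List.all_eq_true]
    constructor
    · intro y hy
      rw [decide_eq_true_eq]
      rcases hcovY y hy with h | ⟨k, hk, -⟩
      · exact h
      · simp at hk
    · intro t ht
      rw [decide_eq_true_eq]
      rcases hcovZ t ht with h | ⟨k, hk, -⟩
      · exact h
      · simp at hk
  | cons k rest ih =>
    intro hnd hgood uY uZ huY hdisjY hcovY huZ hdisjZ hcovZ
    rw [List.nodup_cons] at hnd
    obtain ⟨hkrest, hndrest⟩ := hnd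
    have hgk : good k := hgood k (by simp)
    have hgrest : ∀ k' ∈ rest, good k' := fun k' hk' => hgood k' (by simp [hk'])
    rcases hsz : sz k with ⟨a, b, c⟩
    have hca : #(Av k) = a := by simp [hszA k hgk, hsz]
    have hcb : #(Bv k) = b := by simp [hszB k hgk, hsz]
    have hcc : #(Cv k) = c := by simp [hszC k hgk, hsz]
    rw [List.map_cons, hsz, existsCoverZ, List.any_eq_true]
    -- the lists realising block k
    have hCsub : ∀ x ∈ Cv k, x ∈ YL := by
      intro x hx
      have h := hY k hgk x hx 0 (hB0 k hgk)
      rwa [Nat.sub_zero, Nat.add_mod_right, Nat.mod_eq_of_lt (hCp k x hx)] at h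
    set Cl := YL.filter (fun x => decide (x ∈ Cv k)) with hCl
    set candB := (candShift p Cl fun y => decide (y ∈ YL)).filter (fun x => x != 0) with hcandB
    set Bl := candB.filter (fun x => decide (x ∈ (Bv k).erase 0)) with hBl
    set candA := candShift p Cl (fun t => decide (t ∈ ZL)) with hcandA
    set Al := candA.filter (fun x => decide (x ∈ Av k)) with hAl
    have hClmem : ∀ x, x ∈ Cl ↔ x ∈ Cv k := by
      intro x; rw [hCl, List.mem_filter, decide_eq_true_eq]; exact ⟨fun h => h.2, fun h => ⟨hCsub x h, h⟩⟩
    have hClnd : Cl.Nodup := hYL.filter _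
    have hCllen : Cl.length = c := by rw [hCl, length_filter_mem_of_subset hYL hCsub, hcc]
    have hBsub : ∀ x ∈ (Bv k).erase 0, x ∈ candB := by
      intro x hx
      rw [Finset.mem_erase] at hx
      rw [hcandB, List.mem_filter, mem_candShift]
      refine ⟨⟨hBp k x hx.2, fun c' hc' => ?_⟩, by simpa using hx.1⟩
      rw [decide_eq_true_eq]
      exact hY k hgk c' ((hClmem c').1 hc') x hx.2
    have hcandBnd : candB.Nodup := ((List.nodup_range).filter _).filter _
    have hBlmem : ∀ x, x ∈ Bl ↔ x ∈ (Bv k).erase 0 := by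
      intro x; rw [hBl, List.mem_filter, decide_eq_true_eq]; exact ⟨fun h => h.2, fun h => ⟨hBsub x h, h⟩⟩
    have hBlnd : Bl.Nodup := hcandBnd.filter _
    have hBllen : Bl.length = b - 1 := by
      rw [hBl, length_filter_mem_of_subset hcandBnd hBsub, Finset.card_erase_of_mem (hB0 k hgk), hcb]
    have hB0l : ∀ x, x ∈ (0 :: Bl) ↔ x ∈ Bv k := by
      intro x; rw [List.mem_cons, hBlmem, Finset.mem_erase]
      constructor
      · rintro (rfl | ⟨-, h⟩); exacts [hB0 k hgk, h]
      · intro h; by_cases h0 : x = 0; exacts [Or.inl h0, Or.inr ⟨h0, h⟩]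
    have hB0nd : (0 :: Bl).Nodup := by
      rw [List.nodup_cons]; refine ⟨fun h => ?_, hBlnd⟩
      have := (hBlmem 0).1 h; simp at this
    have hAsub : ∀ x ∈ Av k, x ∈ candA := by
      intro x hx
      rw [hcandA, mem_candShift]
      refine ⟨hAp k x hx, fun c' hc' => ?_⟩
      rw [decide_eq_true_eq]
      exact hZ k hgk c' ((hClmem c').1 hc') x hx
    have hcandAnd : candA.Nodup := (List.nodup_range).filter _
    have hAlmem : ∀ x, x ∈ Al ↔ x ∈ Av k := by
      intro x; rw [hAl, List.mem_filter, decide_eq_true_eq]; exact ⟨fun h => h.2, fun h => ⟨hAsub x h, h⟩⟩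
    have hAlnd : Al.Nodup := hcandAnd.filter _
    have hAllen : Al.length = a := by rw [hAl, length_filter_mem_of_subset hcandAnd hAsub, hca]
    -- the three difference lists are duplicate-free
    have hn1 : (diffList p Cl (0 :: Bl)).Nodup := nodup_diffList hClnd hB0nd fun c₁ hc₁ c₂ hc₂ x₁ hx₁ x₂ hx₂ h =>
      hinjY k hgk c₁ ((hClmem _).1 hc₁) c₂ ((hClmem _).1 hc₂) x₁ ((hB0l _).1 hx₁) x₂ ((hB0l _).1 hx₂) h
    have hn2 : (diffList p Cl Al).Nodup := nodup_diffList hClnd hAlnd fun c₁ hc₁ c₂ hc₂ x₁ hx₁ x₂ hx₂ h =>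
      hinjZ k hgk c₁ ((hClmem _).1 hc₁) c₂ ((hClmem _).1 hc₂) x₁ ((hAlmem _).1 hx₁) x₂ ((hAlmem _).1 hx₂) h
    have hn3 : (diffList p Al (0 :: Bl)).Nodup := nodup_diffList hAlnd hB0nd fun c₁ hc₁ c₂ hc₂ x₁ hx₁ x₂ hx₂ h =>
      hinjX k hgk c₁ ((hAlmem _).1 hc₁) c₂ ((hAlmem _).1 hc₂) x₁ ((hB0l _).1 hx₁) x₂ ((hB0l _).1 hx₂) h
    have hmem : (diffList p Cl (0 :: Bl), diffList p Cl Al) ∈ blockDiffsZ p YL ZL a b c :=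
      mem_blockDiffsZ (List.mem_sublistsLen.2 ⟨List.filter_sublist, hCllen⟩)
        (List.mem_sublistsLen.2 ⟨List.filter_sublist, hBllen⟩) (List.mem_sublistsLen.2 ⟨List.filter_sublist, hAllen⟩) hn1 hn2 hn3
    -- meaning of the two difference lists
    have hYmem : ∀ y, y ∈ diffList p Cl (0 :: Bl) ↔ ∃ c' ∈ Cv k, ∃ x ∈ Bv k, (c' + p - x) % p = y := by
      intro y; rw [mem_diffList]
      constructor
      · rintro ⟨c', hc', x, hx, h⟩; exact ⟨c', (hClmem _).1 hc', x, (hB0l _).1 hx, h⟩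
      · rintro ⟨c', hc', x, hx, h⟩; exact ⟨c', (hClmem _).2 hc', x, (hB0l _).2 hx, h⟩
    have hZmem : ∀ t, t ∈ diffList p Cl Al ↔ ∃ c' ∈ Cv k, ∃ x ∈ Av k, (c' + p - x) % p = t := by
      intro t; rw [mem_diffList]
      constructor
      · rintro ⟨c', hc', x, hx, h⟩; exact ⟨c', (hClmem _).1 hc', x, (hAlmem _).1 hx, h⟩
      · rintro ⟨c', hc', x, hx, h⟩; exact ⟨c', (hClmem _).2 hc', x, (hAlmem _).2 hx, h⟩
    refine ⟨_, hmem, ?_⟩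
    rw [Bool.and_eq_true, Bool.and_eq_true, List.all_eq_true, List.all_eq_true]
    refine ⟨⟨fun y hy => ?_, fun t ht => ?_⟩, ?_⟩
    · rw [Bool.not_eq_true', decide_eq_false_iff_not]
      obtain ⟨c', hc', x, hx, rfl⟩ := (hYmem y).1 hy
      exact huY k (by simp) c' hc' x hx
    · rw [Bool.not_eq_true', decide_eq_false_iff_not]
      obtain ⟨c', hc', x, hx, rfl⟩ := (hZmem t).1 ht
      exact huZ k (by simp) c' hc' x hx
    · -- the recursive call
      apply ih hndrest hgrest
      · intro k' hk' c' hc' x hx hmemY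
        rw [List.mem_append] at hmemY
        rcases hmemY with h | h
        · obtain ⟨c₂, hc₂, x₂, hx₂, h₂⟩ := (hYmem _).1 h
          exact hdisjY k (by simp) k' (by simp [hk']) (fun heq => hkrest (heq ▸ hk')) c₂ hc₂ x₂ hx₂ c' hc' x hx h₂
        · exact huY k' (by simp [hk']) c' hc' x hx h
      · intro k₁ hk₁ k₂ hk₂ hne
        exact hdisjY k₁ (by simp [hk₁]) k₂ (by simp [hk₂]) hne
      · intro y hy
        rcases hcovY y hy with h | ⟨k', hk', c', hc', x, hx, h⟩
        · exact Or.inl (List.mem_append.2 (Or.inr h))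
        · rw [List.mem_cons] at hk'
          rcases hk' with rfl | hk'
          · exact Or.inl (List.mem_append.2 (Or.inl ((hYmem y).2 ⟨c', hc', x, hx, h⟩)))
          · exact Or.inr ⟨k', hk', c', hc', x, hx, h⟩
      · intro k' hk' c' hc' x hx hmemZ
        rw [List.mem_append] at hmemZ
        rcases hmemZ with h | h
        · obtain ⟨c₂, hc₂, x₂, hx₂, h₂⟩ := (hZmem _).1 h
          exact hdisjZ k (by simp) k' (by simp [hk']) (fun heq => hkrest (heq ▸ hk')) c₂ hc₂ x₂ hx₂ c' hc' x hx h₂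
        · exact huZ k' (by simp [hk']) c' hc' x hx h
      · intro k₁ hk₁ k₂ hk₂ hne
        exact hdisjZ k₁ (by simp [hk₁]) k₂ (by simp [hk₂]) hne
      · intro t ht
        rcases hcovZ t ht with h | ⟨k', hk', c', hc', x, hx, h⟩
        · exact Or.inl (List.mem_append.2 (Or.inr h))
        · rw [List.mem_cons] at hk'
          rcases hk' with rfl | hk'
          · exact Or.inl (List.mem_append.2 (Or.inl ((hZmem t).2 ⟨c', hc', x, hx, h⟩)))
          · exact Or.inr ⟨k', hk', c', hc', x, hx, h⟩


end Sound

/-! ## The cover stage for general shapes -/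

section Stage

variable {p : ℕ} [hp : Fact p.Prime] {N : ℕ} {A B C : Fin N → Finset (ZMod p)}

/-- **The exact-cover stage, general `Y°`- and `Z°`-shapes (kernel, UNCONDITIONAL).**  Let `(A, B, C)` be an STPP family with non-empty sets, `i` a block,
`ks` the duplicate-free list of the other indices, `u ≠ 0` a unit, `YL` a duplicate-free list which is EXACTLY the set of values `(u (x − y₀)).val`, `x ∈ Y° = ⋃_{k≠i}(C_k − B_k)`, and `ZL` a list which is
EXACTLY the set of values `(u (x − z₀)).val`, `x ∈ Z° = ⋃_{k≠i}(C_k − A_k)`.  Then `existsCoverZ p YL ZL (ks.map sizes) [] [] = true`. [cite: CohnKleinbergSzegedyUmans2005, Def. 5.1] -/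
theorem existsCoverZ_true_of_isSTPP (hS : IsSTPP A B C) (hA : ∀ k, (A k).Nonempty) (hB : ∀ k, (B k).Nonempty) (hC : ∀ k, (C k).Nonempty)
    (i : Fin N) (ks : List (Fin N)) (hks : ks.Nodup) (hksi : ∀ k, k ∈ ks ↔ k ≠ i)
    {u : ZMod p} (hu0 : u ≠ 0) {YL ZL : List ℕ} (hYLnd : YL.Nodup) {y₀ z₀ : ZMod p}
    (hYin : ∀ x ∈ DU B C (univ.erase i), (u * (x - y₀)).val ∈ YL)
    (hYsurj : ∀ y ∈ YL, ∃ x ∈ DU B C (univ.erase i), (u * (x - y₀)).val = y)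
    (hZin : ∀ x ∈ DU A C (univ.erase i), (u * (x - z₀)).val ∈ ZL)
    (hZsurj : ∀ t ∈ ZL, ∃ x ∈ DU A C (univ.erase i), (u * (x - z₀)).val = t) :
    existsCoverZ p YL ZL (ks.map fun k => (#(A k), #(B k), #(C k))) [] [] = true := by
  have hbs : ∀ k, ∃ x, x ∈ B k := fun k => hB k
  choose bs hbsmem using hbs
  set φB : Fin N → ZMod p → ZMod p := fun k x => u * (x - bs k) with hφB
  set φC : Fin N → ZMod p → ZMod p := fun k x => u * (x - bs k - y₀) with hφC
  set φA : Fin N → ZMod p → ZMod p := fun k x => u * (x - bs k - y₀ + z₀) with hφA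
  have hinjB : ∀ k, Function.Injective (φB k) := fun k x x' h => by
    have := mul_left_cancel₀ hu0 h; simpa using this
  have hinjC : ∀ k, Function.Injective (φC k) := fun k x x' h => by
    have := mul_left_cancel₀ hu0 h; simpa using this
  have hinjA : ∀ k, Function.Injective (φA k) := fun k x x' h => by
    have := mul_left_cancel₀ hu0 h; simpa using this
  have hvinj : Function.Injective (ZMod.val : ZMod p → ℕ) := ZMod.val_injective p
  set Av : Fin N → Finset ℕ := fun k => (A k).image (fun x => (φA k x).val) with hAv
  set Bv : Fin N → Finset ℕ := fun k => (B k).image (fun x => (φB k x).val) with hBv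
  set Cv : Fin N → Finset ℕ := fun k => (C k).image (fun x => (φC k x).val) with hCv
  -- differences of normalised values
  have hdiffCB : ∀ k, ∀ c₀ ∈ C k, ∀ b₀ ∈ B k, ((φC k c₀).val + p - (φB k b₀).val) % p = (u * (c₀ - b₀ - y₀)).val := by
    intro k c₀ _ b₀ _
    rw [← val_sub_eq_mod]
    congr 1
    simp only [hφC, hφB]; ring
  have hdiffCA : ∀ k, ∀ c₀ ∈ C k, ∀ a₀ ∈ A k, ((φC k c₀).val + p - (φA k a₀).val) % p = (u * (c₀ - a₀ - z₀)).val := by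
    intro k c₀ _ a₀ _
    rw [← val_sub_eq_mod]
    congr 1
    simp only [hφC, hφA]; ring
  have hdiffAB : ∀ k, ∀ a₀ ∈ A k, ∀ b₀ ∈ B k, ((φA k a₀).val + p - (φB k b₀).val) % p = (u * (a₀ - b₀ - y₀ + z₀)).val := by
    intro k a₀ _ b₀ _
    rw [← val_sub_eq_mod]
    congr 1
    simp only [hφA, hφB]; ring
  -- elements of the difference sets of other blocks lie in Y° / Z°
  have hYmem : ∀ k, k ≠ i → ∀ c₀ ∈ C k, ∀ b₀ ∈ B k, c₀ - b₀ ∈ DU B C (univ.erase i) := fun k hk c₀ hc₀ b₀ hb₀ =>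
    D_subset_DU (Finset.mem_erase.2 ⟨hk, Finset.mem_univ k⟩) (mem_D.2 ⟨b₀, hb₀, c₀, hc₀, rfl⟩)
  have hZmem : ∀ k, k ≠ i → ∀ c₀ ∈ C k, ∀ a₀ ∈ A k, c₀ - a₀ ∈ DU A C (univ.erase i) := fun k hk c₀ hc₀ a₀ ha₀ =>
    D_subset_DU (Finset.mem_erase.2 ⟨hk, Finset.mem_univ k⟩) (mem_D.2 ⟨a₀, ha₀, c₀, hc₀, rfl⟩)
  -- run the sound search
  have hiA : ∀ k, Function.Injective (fun x => (φA k x).val) := fun k x x' h => hinjA k (hvinj h)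
  have hiB : ∀ k, Function.Injective (fun x => (φB k x).val) := fun k x x' h => hinjB k (hvinj h)
  have hiC : ∀ k, Function.Injective (fun x => (φC k x).val) := fun k x x' h => hinjC k (hvinj h)
  have hksne : ∀ k ∈ ks, k ≠ i := fun k hk => (hksi k).1 hk
  refine existsCoverZ_complete (p := p) (ZL := ZL) hYLnd (fun k => k ≠ i) (fun k => (#(A k), #(B k), #(C k))) Av Bv Cv
    (fun k _ => by simp only [hAv]; rw [Finset.card_image_of_injective _ (hiA k)])
    (fun k _ => by simp only [hBv]; rw [Finset.card_image_of_injective _ (hiB k)])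
    (fun k _ => by simp only [hCv]; rw [Finset.card_image_of_injective _ (hiC k)])
    (fun k x hx => by obtain ⟨y, -, rfl⟩ := Finset.mem_image.1 hx; exact ZMod.val_lt _)
    (fun k x hx => by obtain ⟨y, -, rfl⟩ := Finset.mem_image.1 hx; exact ZMod.val_lt _)
    (fun k x hx => by obtain ⟨y, -, rfl⟩ := Finset.mem_image.1 hx; exact ZMod.val_lt _)
    (fun k _ => Finset.mem_image.2 ⟨bs k, hbsmem k, by simp [hφB]⟩)
    ?hY ?hZ ?hinjY ?hinjZ ?hinjX ks hks hksne [] [] (by simp) ?hdY ?hcY (by simp) ?hdZ ?hcZ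
  case hY =>
    intro k hk c hc x hx
    obtain ⟨c₀, hc₀, rfl⟩ := Finset.mem_image.1 hc
    obtain ⟨b₀, hb₀, rfl⟩ := Finset.mem_image.1 hx
    rw [hdiffCB k c₀ hc₀ b₀ hb₀]
    exact hYin _ (hYmem k hk c₀ hc₀ b₀ hb₀)
  case hZ =>
    intro k hk c hc x hx
    obtain ⟨c₀, hc₀, rfl⟩ := Finset.mem_image.1 hc
    obtain ⟨a₀, ha₀, rfl⟩ := Finset.mem_image.1 hx
    rw [hdiffCA k c₀ hc₀ a₀ ha₀]
    exact hZin _ (hZmem k hk c₀ hc₀ a₀ ha₀)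
  case hinjY =>
    intro k _ c hc c' hc' x hx x' hx' heq
    obtain ⟨c₀, hc₀, rfl⟩ := Finset.mem_image.1 hc
    obtain ⟨c₁, hc₁, rfl⟩ := Finset.mem_image.1 hc'
    obtain ⟨b₀, hb₀, rfl⟩ := Finset.mem_image.1 hx
    obtain ⟨b₁, hb₁, rfl⟩ := Finset.mem_image.1 hx'
    rw [hdiffCB k c₀ hc₀ b₀ hb₀, hdiffCB k c₁ hc₁ b₁ hb₁] at heq
    have h1 : c₀ - b₀ = c₁ - b₁ := by
      have := mul_left_cancel₀ hu0 (hvinj heq); linear_combination this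
    obtain ⟨e1, e2⟩ := sub_injOn_of_card_D (card_D_BC hS hA k) hb₀ hb₁ hc₀ hc₁ h1
    exact ⟨by rw [e2], by rw [e1]⟩
  case hinjZ =>
    intro k _ c hc c' hc' x hx x' hx' heq
    obtain ⟨c₀, hc₀, rfl⟩ := Finset.mem_image.1 hc
    obtain ⟨c₁, hc₁, rfl⟩ := Finset.mem_image.1 hc'
    obtain ⟨a₀, ha₀, rfl⟩ := Finset.mem_image.1 hx
    obtain ⟨a₁, ha₁, rfl⟩ := Finset.mem_image.1 hx'
    rw [hdiffCA k c₀ hc₀ a₀ ha₀, hdiffCA k c₁ hc₁ a₁ ha₁] at heq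
    have h1 : c₀ - a₀ = c₁ - a₁ := by
      have := mul_left_cancel₀ hu0 (hvinj heq); linear_combination this
    obtain ⟨e1, e2⟩ := sub_injOn_of_card_D (card_D_AC hS hB k) ha₀ ha₁ hc₀ hc₁ h1
    exact ⟨by rw [e2], by rw [e1]⟩
  case hinjX =>
    intro k _ c hc c' hc' x hx x' hx' heq
    obtain ⟨a₀, ha₀, rfl⟩ := Finset.mem_image.1 hc
    obtain ⟨a₁, ha₁, rfl⟩ := Finset.mem_image.1 hc'
    obtain ⟨b₀, hb₀, rfl⟩ := Finset.mem_image.1 hx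
    obtain ⟨b₁, hb₁, rfl⟩ := Finset.mem_image.1 hx'
    rw [hdiffAB k a₀ ha₀ b₀ hb₀, hdiffAB k a₁ ha₁ b₁ hb₁] at heq
    have h1 : b₀ - a₀ = b₁ - a₁ := by
      have := mul_left_cancel₀ hu0 (hvinj heq); linear_combination (-1 : ZMod p) * this
    obtain ⟨e1, e2⟩ := sub_injOn_of_card_D (card_D_AB hS hC k) ha₀ ha₁ hb₀ hb₁ h1
    exact ⟨by rw [e1], by rw [e2]⟩
  case hdY =>
    intro k hk k' hk' hne c hc x hx c' hc' x' hx' heq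
    obtain ⟨c₀, hc₀, rfl⟩ := Finset.mem_image.1 hc
    obtain ⟨b₀, hb₀, rfl⟩ := Finset.mem_image.1 hx
    obtain ⟨c₁, hc₁, rfl⟩ := Finset.mem_image.1 hc'
    obtain ⟨b₁, hb₁, rfl⟩ := Finset.mem_image.1 hx'
    rw [hdiffCB k c₀ hc₀ b₀ hb₀, hdiffCB k' c₁ hc₁ b₁ hb₁] at heq
    have h1 : c₀ - b₀ = c₁ - b₁ := by
      have := mul_left_cancel₀ hu0 (hvinj heq); linear_combination this
    have hm0 : c₀ - b₀ ∈ D B C k := mem_D.2 ⟨b₀, hb₀, c₀, hc₀, rfl⟩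
    have hm1 : c₁ - b₁ ∈ D B C k' := mem_D.2 ⟨b₁, hb₁, c₁, hc₁, rfl⟩
    rw [h1] at hm0
    exact Finset.disjoint_left.1 (disjoint_D_BC hS hA hne) hm0 hm1
  case hcY =>
    intro y hyin
    obtain ⟨x, hxYo, hxy⟩ := hYsurj y hyin
    obtain ⟨k, hk, hyk⟩ := Finset.mem_biUnion.1 hxYo
    obtain ⟨b₀, hb₀, c₀, hc₀, hcb⟩ := mem_D.1 hyk
    refine Or.inr ⟨k, (hksi k).2 (Finset.mem_erase.1 hk).1, (φC k c₀).val, Finset.mem_image.2 ⟨c₀, hc₀, rfl⟩,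
      (φB k b₀).val, Finset.mem_image.2 ⟨b₀, hb₀, rfl⟩, ?_⟩
    rw [hdiffCB k c₀ hc₀ b₀ hb₀, hcb, ← hxy]
  case hdZ =>
    intro k hk k' hk' hne c hc x hx c' hc' x' hx' heq
    obtain ⟨c₀, hc₀, rfl⟩ := Finset.mem_image.1 hc
    obtain ⟨a₀, ha₀, rfl⟩ := Finset.mem_image.1 hx
    obtain ⟨c₁, hc₁, rfl⟩ := Finset.mem_image.1 hc'
    obtain ⟨a₁, ha₁, rfl⟩ := Finset.mem_image.1 hx'
    rw [hdiffCA k c₀ hc₀ a₀ ha₀, hdiffCA k' c₁ hc₁ a₁ ha₁] at heq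
    have h1 : c₀ - a₀ = c₁ - a₁ := by
      have := mul_left_cancel₀ hu0 (hvinj heq); linear_combination this
    have hm0 : c₀ - a₀ ∈ D A C k := mem_D.2 ⟨a₀, ha₀, c₀, hc₀, rfl⟩
    have hm1 : c₁ - a₁ ∈ D A C k' := mem_D.2 ⟨a₁, ha₁, c₁, hc₁, rfl⟩
    rw [h1] at hm0
    exact Finset.disjoint_left.1 (disjoint_D_AC hS hB hne) hm0 hm1
  case hcZ =>
    intro t ht
    obtain ⟨x, hxZo, hxt⟩ := hZsurj t ht
    obtain ⟨k, hk, hzk⟩ := Finset.mem_biUnion.1 hxZo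
    obtain ⟨a₀, ha₀, c₀, hc₀, hca⟩ := mem_D.1 hzk
    refine Or.inr ⟨k, (hksi k).2 (Finset.mem_erase.1 hk).1, (φC k c₀).val, Finset.mem_image.2 ⟨c₀, hc₀, rfl⟩,
      (φA k a₀).val, Finset.mem_image.2 ⟨a₀, ha₀, rfl⟩, ?_⟩
    rw [hdiffCA k c₀ hc₀ a₀ ha₀, hca, ← hxt]

end Stage

end Summit.MatrixMultiplication.OmegaCensus.CubeNB
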